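import Mathlib
import HarnessLib

/-!
# Integrating the sampling inequality over node panels (handoff prove-1, ATTEMPT-17 §5; the bookkeeping of step (TB-2) of LEMMA TB)

Step (TB-2) of LEMMA TB (HOME handoff/IDEAS-prolate.md §87.3 (2)) integrates the pointwise sampling
inequality (TB-1) — `F(t) ≤ 2 Λ₂(t)² Σ_{γ ∈ J(t)} F(γ) + 4 R(t)²` for `F = |Ĝ(1/2 + i·)|²`, with the node
window `J(t)` piecewise constant in `t` (`HandoffLineSampling.norm_sq_weilMellin_line_le_sampling`
on each panel) — over the band `[H₁, T′]`, regroups the double sum by node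
(`Σ_γ w_γ F(γ)`, `w_γ = Σ_{panels ∋ γ} ∫_{panel} Λ₂²`), bounds the node weights by the kernel weights
(`w_γ ≤ W (1 - α_γ) Φ(γ)`), and pays for the continuum beyond `T′` with the kernel's opacity
(`1 - Φ ≥ m_{T′}` there).  This file proves exactly these bookkeeping steps as real-analysis lemmas
with the pointwise inequality as a hypothesis (Mathlib-only imports, so it does not wait for any
`Summits` build):

* `intervalIntegral_le_sum_panels` — `∫_{τ₀}^{τ_M} F ≤ Σ_{i<M} [2 (∫_{τᵢ}^{τᵢ₊₁} Λᵢ) Σ_{γ ∈ Jᵢ} F(γ) + 4 ∫_{τᵢ}^{τᵢ₊₁} Rᵢ]`;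
* `sum_panels_regroup` — `Σ_{i<M} cᵢ Σ_{γ ∈ Jᵢ} F(γ) = Σ_{γ ∈ ⋃ Jᵢ} (Σ_{i<M, γ ∈ Jᵢ} cᵢ) F(γ)`;
* `sum_weights_le` — `Σ_γ w_γ F(γ) ≤ W Σ_γ ((1 - α_γ) Φ_γ) F(γ)` when `w_γ ≤ W (1 - α_γ) Φ_γ`, `F ≥ 0`;
* `setIntegral_le_inv_mul_integral_of_opacity` — `∫_{S} F ≤ m⁻¹ ∫ (1 - Φ) F` when `1 - Φ ≥ m > 0`
  on `S` and `0 ≤ F`, `Φ ≤ 1`.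

Nothing in this file bears on the truth of RH.
-/

set_option linter.dupNamespace false

open scoped Real
open MeasureTheory Set Filter intervalIntegral

namespace Summit.RiemannHypothesis.RiemannHypothesis.Theorems

/-- **(TB-2), integration over panels.** If on each panel `[τᵢ, τᵢ₊₁]` (`i < M`, `τ` monotone) the
function `F` satisfies the sampling inequality `F(t) ≤ 2 Λᵢ(t) Σ_{γ ∈ Jᵢ} F(γ) + 4 Rᵢ(t)`, then
`∫_{τ₀}^{τ_M} F ≤ Σ_{i<M} [2 (∫_{τᵢ}^{τᵢ₊₁} Λᵢ) Σ_{γ ∈ Jᵢ} F(γ) + 4 ∫_{τᵢ}^{τᵢ₊₁} Rᵢ]`. -/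
theorem intervalIntegral_le_sum_panels {F : ℝ → ℝ} {τ : ℕ → ℝ} {M : ℕ} (hτ : Monotone τ)
    (hF : ∀ i < M, IntervalIntegrable F volume (τ i) (τ (i + 1)))
    {J : ℕ → Finset ℝ} {Λ R : ℕ → ℝ → ℝ}
    (hΛ : ∀ i < M, IntervalIntegrable (Λ i) volume (τ i) (τ (i + 1)))
    (hR : ∀ i < M, IntervalIntegrable (R i) volume (τ i) (τ (i + 1)))
    (hpt : ∀ i < M, ∀ t ∈ Icc (τ i) (τ (i + 1)),
      F t ≤ 2 * Λ i t * (∑ γ ∈ J i, F γ) + 4 * R i t) :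
    ∫ t in τ 0..τ M, F t ≤
      ∑ i ∈ Finset.range M,
        (2 * (∫ t in τ i..τ (i + 1), Λ i t) * (∑ γ ∈ J i, F γ) + 4 * ∫ t in τ i..τ (i + 1), R i t) := by
  rw [← intervalIntegral.sum_integral_adjacent_intervals hF]
  refine Finset.sum_le_sum fun i hi ↦ ?_
  have hiM := Finset.mem_range.1 hi
  have hle : τ i ≤ τ (i + 1) := hτ (Nat.le_succ i)
  have hrhs : IntervalIntegrable (fun t ↦ 2 * Λ i t * (∑ γ ∈ J i, F γ) + 4 * R i t) volume
      (τ i) (τ (i + 1)) :=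
    (((hΛ i hiM).const_mul 2).mul_const _).add ((hR i hiM).const_mul 4)
  calc ∫ t in τ i..τ (i + 1), F t
      ≤ ∫ t in τ i..τ (i + 1), (2 * Λ i t * (∑ γ ∈ J i, F γ) + 4 * R i t) :=
        intervalIntegral.integral_mono_on hle (hF i hiM) hrhs (fun t ht ↦ hpt i hiM t ht)
    _ = 2 * (∫ t in τ i..τ (i + 1), Λ i t) * (∑ γ ∈ J i, F γ) + 4 * ∫ t in τ i..τ (i + 1), R i t := by
        rw [intervalIntegral.integral_add (((hΛ i hiM).const_mul 2).mul_const _) ((hR i hiM).const_mul 4),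
          intervalIntegral.integral_mul_const, intervalIntegral.integral_const_mul,
          intervalIntegral.integral_const_mul]

/-- **Regrouping by node.** `Σ_{i<M} cᵢ Σ_{γ ∈ Jᵢ} F(γ) = Σ_{γ ∈ ⋃_{i<M} Jᵢ} (Σ_{i<M : γ ∈ Jᵢ} cᵢ) F(γ)`
(the node weight `w_γ = Σ_{panels ∋ γ} cᵢ`). -/
theorem sum_panels_regroup (c : ℕ → ℝ) (J : ℕ → Finset ℝ) (F : ℝ → ℝ) (M : ℕ) :
    ∑ i ∈ Finset.range M, c i * ∑ γ ∈ J i, F γ =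
      ∑ γ ∈ (Finset.range M).biUnion J,
        (∑ i ∈ (Finset.range M).filter (fun i ↦ γ ∈ J i), c i) * F γ := by
  classical
  set U := (Finset.range M).biUnion J with hU
  have hsub : ∀ i ∈ Finset.range M, J i ⊆ U := fun i hi ↦ Finset.subset_biUnion_of_mem J hi
  -- rewrite each inner sum as a sum over `U` with an indicator
  have h1 : ∀ i ∈ Finset.range M,
      c i * ∑ γ ∈ J i, F γ = ∑ γ ∈ U, (if γ ∈ J i then c i else 0) * F γ := by
    intro i hi
    rw [Finset.mul_sum]
    rw [← Finset.sum_filter_add_sum_filter_not U (fun γ ↦ γ ∈ J i)]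
    have hfil : U.filter (fun γ ↦ γ ∈ J i) = J i := by
      ext γ; simp only [Finset.mem_filter]; exact ⟨fun h ↦ h.2, fun h ↦ ⟨hsub i hi h, h⟩⟩
    rw [hfil]
    have hz : ∑ γ ∈ U.filter (fun γ ↦ ¬ γ ∈ J i), (if γ ∈ J i then c i else 0) * F γ = 0 :=
      Finset.sum_eq_zero fun γ hγ ↦ by rw [if_neg (Finset.mem_filter.1 hγ).2, zero_mul]
    rw [hz, add_zero]
    exact Finset.sum_congr rfl fun γ hγ ↦ by rw [if_pos hγ]
  rw [Finset.sum_congr rfl h1, Finset.sum_comm]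
  refine Finset.sum_congr rfl fun γ _ ↦ ?_
  rw [← Finset.sum_mul, Finset.sum_filter]

/-- **Node weights against kernel weights.** If `w_γ ≤ W · ((1 - α_γ) Φ_γ)` for every node and
`F ≥ 0`, then `Σ_γ w_γ F(γ) ≤ W · Σ_γ (1 - α_γ) Φ_γ F(γ)`. -/
theorem sum_weights_le {U : Finset ℝ} {w α Φ F : ℝ → ℝ} {W : ℝ}
    (hw : ∀ γ ∈ U, w γ ≤ W * ((1 - α γ) * Φ γ)) (hF : ∀ γ ∈ U, 0 ≤ F γ) :
    ∑ γ ∈ U, w γ * F γ ≤ W * ∑ γ ∈ U, (1 - α γ) * Φ γ * F γ := by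
  rw [Finset.mul_sum]
  exact Finset.sum_le_sum fun γ hγ ↦ by
    calc w γ * F γ ≤ W * ((1 - α γ) * Φ γ) * F γ := mul_le_mul_of_nonneg_right (hw γ hγ) (hF γ hγ)
      _ = W * ((1 - α γ) * Φ γ * F γ) := by ring

/-- **Opacity beyond the continuum edge.** If `0 ≤ F`, `Φ ≤ 1` everywhere, `(1 - Φ) F` is
integrable, and `1 - Φ(t) ≥ m > 0` on a measurable set `S`, then `∫_S F ≤ m⁻¹ ∫ (1 - Φ) F`. -/
theorem setIntegral_le_inv_mul_integral_of_opacity {F Φ : ℝ → ℝ} {S : Set ℝ} {m : ℝ}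
    (hS : MeasurableSet S) (hm : 0 < m) (hF0 : ∀ t, 0 ≤ F t) (hΦ1 : ∀ t, Φ t ≤ 1)
    (hint : Integrable fun t ↦ (1 - Φ t) * F t) (hFS : IntegrableOn F S)
    (hop : ∀ t ∈ S, m ≤ 1 - Φ t) :
    ∫ t in S, F t ≤ m⁻¹ * ∫ t, (1 - Φ t) * F t := by
  have h1 : ∫ t in S, F t ≤ ∫ t in S, m⁻¹ * ((1 - Φ t) * F t) := by
    refine setIntegral_mono_on hFS (hint.const_mul _).integrableOn hS fun t ht ↦ ?_
    have hFt := hF0 t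
    calc F t = m⁻¹ * (m * F t) := by field_simp
      _ ≤ m⁻¹ * ((1 - Φ t) * F t) :=
        mul_le_mul_of_nonneg_left (mul_le_mul_of_nonneg_right (hop t ht) hFt) (inv_pos.2 hm).le
  have h2 : ∫ t in S, (1 - Φ t) * F t ≤ ∫ t, (1 - Φ t) * F t :=
    setIntegral_le_integral hint
      (Eventually.of_forall fun t ↦ mul_nonneg (sub_nonneg.2 (hΦ1 t)) (hF0 t))
  calc ∫ t in S, F t ≤ ∫ t in S, m⁻¹ * ((1 - Φ t) * F t) := h1
    _ = m⁻¹ * ∫ t in S, (1 - Φ t) * F t := MeasureTheory.integral_const_mul _ _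
    _ ≤ m⁻¹ * ∫ t, (1 - Φ t) * F t := mul_le_mul_of_nonneg_left h2 (inv_pos.2 hm).le

end Summit.RiemannHypothesis.RiemannHypothesis.Theorems
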